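/-
COR-CM (cell pub-hodgecm2, stage 2 of the Hodge ladder) — count-neutral KERNEL COMBINATORICS «the octic product column G = Q₈ × B, D₄ × B, I: the model»
(seat prover-pub-hodgecm2-b23-g45-0, binder prover b23, gen 45; own census lane OCTIC-PRODUCT, claim HOME/INBOX.md l.18829).  Bookkeeping definitions with
bodies (the motion of the CENTRAL `y` and its translates, the place map `plZ`) + theorems, on top of gen 44ʼs `Census/QuarticInversion{Model,Hodge,Faces,Motion,
Potential,Descent}` used BY NAME; no `decide` table, no certificate, no named fact, no geometry, no `sorry`.  `Interfaces.lean` (C1), every E term, B01,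
`Transposition/*`, `PortJoin/*`, `D2Bridge/*` untouched.
HONEST FRAMING: `HC_CM` is NOT proved, here or anywhere in the tree; nothing here is a period, a count of record or a headline.
T5: n/a-class (no hypothesis binders); checker: self, 2026-08-24.
-/
import Summits.HodgeConjecture.CorCM.Census.QuarticInversionDescent

/-!
# The octic product column `Q₈ × B` and `D₄ × B` (central `B`), I: the model — the motion of a CENTRAL `y` on quadruples of slice labels

THE GROUPS.  `B` is a finite abelian group (written `A` in the code, as in the slice files), `H₀ = ℤ/2 × B` with `c = (1,0)`, and for `ζ ∈ ℤ/2`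
  `G'_ζ(B) = ⟨H₀, y, t | y h y⁻¹ = h, t h t⁻¹ = h (h ∈ H₀), y² = (ζ, 0), t² = c, t y t⁻¹ = c·y⟩`
of order `8|B|`: `H = ⟨H₀, t⟩ ≅ ℤ/4 × B` (b09ʼs quartic twist, `c = t²`) and `y` inverts `t` (`y t y⁻¹ = t⁻¹`) but — in contrast with gen 44ʼs quartic
inversion twists `G_ζ(B)` (`Census/QuarticInversionModel.lean`), where `y` inverts all of `H₀` — here `y` CENTRALISES `B`:
  **`G'_1(B) = Q₈ × B`** (`y² = c`; `⟨t, y⟩ = Q₈` with `−1 = c`) and **`G'_0(B) = D₄ × B`** (`y² = 1`; `⟨t, y⟩ = D₄` with `c = r²`).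
In field language: the Galois CM fields `F = K·L` with `K` a Galois CM OCTIC field of quaternion resp. dihedral type and `L` a totally real Galois field with
group `B` linearly disjoint from `K`, complex conjugation `= (−1, 0)` resp. `(r², 0)`.

THE MODEL.  As in gen 44 (iterated index-two descent `G ⊃ M = H₀ ⊔ yH₀ ⊃ H₀`), an abstract CM type of `(G'_ζ(B), c)` is a quadruple of slice labels
`Θ = ((ψ₀, ψ₁), (ψ₂, ψ₃)) ∈ Ty₄ B` (coset order `H₀, yH₀, tH₀, tyH₀`); the motions of `H₀` (`twH₄`) and of `t` (`twT`) are gen 44ʼs VERBATIM, and the motion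
of the central `y` is the UNREVERSED swap
  **`twZ ζ ((ψ₀,ψ₁),(ψ₂,ψ₃)) = ((ψ₁, ψ₀ + ζ), (ψ₃, ψ₂ + ζ))`**
(gen 44ʼs `twY ζ` composed with the reversal `ψ ↦ ψ(−·)` of all four coordinates).  §1: the defining relations on labels (`twZ_twZ : twZ² = twH₄ (ζ,0)`,
**`twZ_twH₄ : twZ ∘ twH₄ g = twH₄ g ∘ twZ`** — `y` central on `H₀` —, **`twZ_twT : twZ ∘ twT = twH₄ c ∘ twT ∘ twZ`**), the translate `translZ`; §2: the
pair-marginals of a `y`-translate (`Marg₀_translZ`, `Marg₁_translZ`) and the stability of gen 44ʼs Hodge lattice `hodge₄` and pairs `pairs₄` under `translZ`;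
§3: flips, conjugation and faces are `y`-equivariant (`twZ_flipAt` with the place map `plZ (k, i) = (σY k, i)`, `translZ_faceVec₄`, `translZ_mem_faceSet₄`);
§4: the potential and gen 44ʼs reducing pairs are `y`-invariant (`pot₄_twZ`, `reducing_twZ`).  Everything else of parts I–IX of the quartic inversion
lane (faces, potential, descent, functionals, key lemma, relations, closing vectors, normal form) is label-level and is used BY NAME in the sequel.
All [folklore] (Pohlmannʼs dictionary [Pohlmann1968, Thm 1] along an iterated index-two descent).

## References
* [Pohlmann1968] H. Pohlmann, Algebraic cycles on abelian varieties of complex multiplication type, Ann. of Math. 88 (1968), Thm 1.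
* [Milne1999] J. S. Milne, Lefschetz motives and the Tate conjecture, Compositio Math. 117 (1999), Prop. 2.1, p. 54.
-/

namespace Summit.HodgeConjecture.CorCM.Census.OcticProduct

open Finset
open Summit.HodgeConjecture.CorCM.Census.OddSliceFacesModel
open Summit.HodgeConjecture.CorCM.Census.DicyclicTwist (Ty₂ twH twH_twH twH_zero twHEquiv marg₀ marg₁ marg₀_apply marg₁_apply hodge₂ mem_hodge₂_iff)
open Summit.HodgeConjecture.CorCM.Census.OddSliceFacesSquares (clsTy)
open Summit.HodgeConjecture.CorCM.Census.QuarticInversion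

noncomputable section

/-! ## §1 The motion of the central `y` -/

section Labels

variable (A : Type) [AddCommGroup A] [DecidableEq A]

/-- **The unreversed swap with square class `ζ`** on pairs: `twV ζ (ψ₀, ψ₁) = (ψ₁, ψ₀ + ζ)`. [folklore] -/
def twV (ζ : ZMod 2) (Ψ : Ty₂ A) : Ty₂ A := (Ψ.2, Ψ.1 + cst A ζ)

/-- Its inverse: `(ψ₀, ψ₁) ↦ (ψ₁ + ζ, ψ₀)`. [folklore] -/
def twVinv (ζ : ZMod 2) (Ψ : Ty₂ A) : Ty₂ A := (Ψ.2 + cst A ζ, Ψ.1)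

omit [AddCommGroup A] [DecidableEq A] in
/-- `twVinv ∘ twV = id`. [folklore] -/
@[simp] theorem twVinv_twV (ζ : ZMod 2) (Ψ : Ty₂ A) : twVinv A ζ (twV A ζ Ψ) = Ψ := by
  obtain ⟨ψ₀, ψ₁⟩ := Ψ
  simp only [twV, twVinv, add_assoc, cst_add_cst, add_zero]

omit [AddCommGroup A] [DecidableEq A] in
/-- `twV ∘ twVinv = id`. [folklore] -/
@[simp] theorem twV_twVinv (ζ : ZMod 2) (Ψ : Ty₂ A) : twV A ζ (twVinv A ζ Ψ) = Ψ := by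
  obtain ⟨ψ₀, ψ₁⟩ := Ψ
  simp only [twV, twVinv, add_assoc, cst_add_cst, add_zero]

omit [DecidableEq A] in
/-- `twV ζ ∘ twV ζ = twH (ζ, 0)` on pairs. [folklore] -/
theorem twV_twV (ζ : ZMod 2) (Ψ : Ty₂ A) : twV A ζ (twV A ζ Ψ) = twH A (ζ, 0) Ψ := by
  obtain ⟨ψ₀, ψ₁⟩ := Ψ
  simp only [twV, twH, tw_cst_zero]

omit [DecidableEq A] in
/-- **`y` centralises `H₀` on pairs**: `twV ζ ∘ twH g = twH g ∘ twV ζ`. [folklore] -/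
theorem twV_twH (ζ : ZMod 2) (g : ZMod 2 × A) (Ψ : Ty₂ A) : twV A ζ (twH A g Ψ) = twH A g (twV A ζ Ψ) := by
  obtain ⟨ψ₀, ψ₁⟩ := Ψ
  simp only [twV, twH, tw_add_cst]

/-- **The motion of the central `y`**: the unreversed swap with square class `ζ` on both pairs. [folklore] -/
def twZ (ζ : ZMod 2) (Θ : Ty₄ A) : Ty₄ A := (twV A ζ Θ.1, twV A ζ Θ.2)

/-- The motion of `y⁻¹`. [folklore] -/
def twZinv (ζ : ZMod 2) (Θ : Ty₄ A) : Ty₄ A := (twVinv A ζ Θ.1, twVinv A ζ Θ.2)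

omit [AddCommGroup A] [DecidableEq A] in
/-- `y⁻¹ y = 1` on labels. [folklore] -/
@[simp] theorem twZinv_twZ (ζ : ZMod 2) (Θ : Ty₄ A) : twZinv A ζ (twZ A ζ Θ) = Θ := by
  simp only [twZ, twZinv, twVinv_twV]

omit [AddCommGroup A] [DecidableEq A] in
/-- `y y⁻¹ = 1` on labels. [folklore] -/
@[simp] theorem twZ_twZinv (ζ : ZMod 2) (Θ : Ty₄ A) : twZ A ζ (twZinv A ζ Θ) = Θ := by
  simp only [twZ, twZinv, twV_twVinv]

omit [DecidableEq A] in
/-- **`y² = (ζ, 0)`**: `twZ ζ ∘ twZ ζ = twH₄ (ζ, 0)`. [folklore] -/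
theorem twZ_twZ (ζ : ZMod 2) (Θ : Ty₄ A) : twZ A ζ (twZ A ζ Θ) = twH₄ A (ζ, 0) Θ := by
  simp only [twZ, twH₄, twV_twV]

omit [DecidableEq A] in
/-- **`y` is central on `H₀`**: `twZ ζ ∘ twH₄ g = twH₄ g ∘ twZ ζ`. [folklore] -/
theorem twZ_twH₄ (ζ : ZMod 2) (g : ZMod 2 × A) (Θ : Ty₄ A) : twZ A ζ (twH₄ A g Θ) = twH₄ A g (twZ A ζ Θ) := by
  simp only [twZ, twH₄, twV_twH]

omit [AddCommGroup A] [DecidableEq A] in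
/-- `ψ + 1 + 1 = ψ`. [folklore] -/
private theorem add_one_add_one' (ψ : Ty A) : ψ + 1 + 1 = ψ := add_one_add_one A ψ

omit [DecidableEq A] in
/-- **`t⁻¹ y t = c y`**: `twZ ζ ∘ twT = twH₄ (1,0) ∘ twT ∘ twZ ζ` (base changes compose contravariantly). [folklore] -/
theorem twZ_twT (ζ : ZMod 2) (Θ : Ty₄ A) : twZ A ζ (twT A Θ) = twH₄ A (1, 0) (twT A (twZ A ζ Θ)) := by
  obtain ⟨⟨ψ₀, ψ₁⟩, ⟨ψ₂, ψ₃⟩⟩ := Θ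
  rw [twH₄_one_zero]
  refine Prod.ext (Prod.ext rfl ?_) (Prod.ext ?_ ?_)
  · show ψ₂ + cst A ζ = ψ₂ + cst A ζ + 1 + 1
    rw [add_one_add_one']
  · show ψ₁ = ψ₁ + 1 + 1
    rw [add_one_add_one']
  · show ψ₀ + 1 + cst A ζ = ψ₀ + cst A ζ + 1
    rw [add_right_comm]

/-- The motion of the central `y` as a permutation of the labels. [folklore] -/
def twZEquiv (ζ : ZMod 2) : Ty₄ A ≃ Ty₄ A where
  toFun := twZ A ζ
  invFun := twZinv A ζ
  left_inv := twZinv_twZ A ζ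
  right_inv := twZ_twZinv A ζ

/-- The unreversed swap as a permutation of the pairs. [folklore] -/
def twVEquiv (ζ : ZMod 2) : Ty₂ A ≃ Ty₂ A where
  toFun := twV A ζ
  invFun := twVinv A ζ
  left_inv := twVinv_twV A ζ
  right_inv := twV_twVinv A ζ

/-- Translate of an exponent vector by the central `y`. [folklore] -/
def translZ (ζ : ZMod 2) (v : Ty₄ A → ℤ) : Ty₄ A → ℤ := fun Θ => v (twZinv A ζ Θ)

/-- Translation by the central `y` as a `ℤ`-linear map. [folklore] -/
def translZHom (ζ : ZMod 2) : (Ty₄ A → ℤ) →ₗ[ℤ] (Ty₄ A → ℤ) where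
  toFun := translZ A ζ
  map_add' _ _ := rfl
  map_smul' _ _ := rfl

omit [AddCommGroup A] [DecidableEq A] in
/-- `translZHom` is `translZ`. [folklore] -/
@[simp] theorem translZHom_apply (ζ : ZMod 2) (v : Ty₄ A → ℤ) : translZHom A ζ v = translZ A ζ v := rfl

/-- Transport of an `M`-vector along the unreversed swap: `(translV ζ w)(Ψ) = w (twVinv ζ Ψ)`. [folklore] -/
def translV (ζ : ZMod 2) (w : Ty₂ A → ℤ) : Ty₂ A → ℤ := fun Ψ => w (twVinv A ζ Ψ)

end Labels

/-! ## §2 The central `y` preserves the Hodge lattice and the pairs -/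

section Hodge

variable (A : Type) [AddCommGroup A] [Fintype A] [DecidableEq A]

omit [AddCommGroup A] [DecidableEq A] in
/-- Translate of a unit vector by the central `y`. [folklore] -/
theorem translZ_single (ζ : ZMod 2) (Θ : Ty₄ A) (n : ℤ) : translZ A ζ (Pi.single Θ n) = Pi.single (twZ A ζ Θ) n := by
  funext Φ
  have hiff : twZinv A ζ Φ = Θ ↔ Φ = twZ A ζ Θ := by
    constructor
    · intro h; rw [← h, twZ_twZinv]
    · intro h; rw [h, twZinv_twZ]
  simp only [translZ, Pi.single_apply, hiff]

omit [AddCommGroup A] in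
/-- **The `0`-marginal of the swapped vector is the `1`-marginal.** [folklore] -/
theorem marg₀_translV (ζ : ZMod 2) (w : Ty₂ A → ℤ) : marg₀ A (translV A ζ w) = marg₁ A w := by
  funext α
  rw [marg₀_apply, marg₁_apply]
  show ∑ β : Ty A, w (twVinv A ζ (α, β)) = ∑ ψ₀ : Ty A, w (ψ₀, α)
  simp only [twVinv]
  exact Fintype.sum_equiv (Equiv.addRight (cst A ζ)) _ _ fun β => rfl

omit [AddCommGroup A] in
/-- **The `1`-marginal of the swapped vector is the `ζ`-shifted `0`-marginal.** [folklore] -/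
theorem marg₁_translV (ζ : ZMod 2) (w : Ty₂ A → ℤ) : marg₁ A (translV A ζ w) = shiftC A ζ (marg₀ A w) := by
  funext β
  rw [marg₁_apply]
  show ∑ α : Ty A, w (twVinv A ζ (α, β)) = ∑ ψ₁ : Ty A, w (β + cst A ζ, ψ₁)
  rfl

/-- **`hodge₂` is stable under the unreversed swap of either square class.** [folklore] -/
theorem translV_mem (ζ : ZMod 2) {w : Ty₂ A → ℤ} (hw : w ∈ hodge₂ A) : translV A ζ w ∈ hodge₂ A := by
  rw [mem_hodge₂_iff] at hw ⊢
  rw [marg₀_translV, marg₁_translV]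
  exact ⟨hw.2, shiftC_mem A hw.1 ζ⟩

omit [AddCommGroup A] in
/-- **`Marg₀` of the `y`-translate is the swapped `Marg₀`.** [folklore] -/
theorem Marg₀_translZ (ζ : ZMod 2) (v : Ty₄ A → ℤ) : Marg₀ A (translZ A ζ v) = translV A ζ (Marg₀ A v) := by
  funext Ψ
  rw [Marg₀_apply]
  show ∑ Ψ' : Ty₂ A, v (twZinv A ζ (Ψ, Ψ')) = ∑ Ψ' : Ty₂ A, v (twVinv A ζ Ψ, Ψ')
  exact Fintype.sum_equiv (twVEquiv A ζ).symm _ _ fun Ψ' => rfl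

omit [AddCommGroup A] in
/-- **`Marg₁` of the `y`-translate is the swapped `Marg₁`.** [folklore] -/
theorem Marg₁_translZ (ζ : ZMod 2) (v : Ty₄ A → ℤ) : Marg₁ A (translZ A ζ v) = translV A ζ (Marg₁ A v) := by
  funext Ψ'
  rw [Marg₁_apply]
  show ∑ Ψ : Ty₂ A, v (twZinv A ζ (Ψ, Ψ')) = ∑ Ψ : Ty₂ A, v (Ψ, twVinv A ζ Ψ')
  exact Fintype.sum_equiv (twVEquiv A ζ).symm _ _ fun Ψ => rfl

/-- **`H₄` is stable under the motion of the central `y`.** [folklore] -/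
theorem translZ_mem (ζ : ZMod 2) {v : Ty₄ A → ℤ} (hv : v ∈ hodge₄ A) : translZ A ζ v ∈ hodge₄ A := by
  rw [mem_hodge₄_iff] at hv ⊢
  rw [Marg₀_translZ, Marg₁_translZ]
  exact ⟨translV_mem A ζ hv.1, translV_mem A ζ hv.2⟩

omit [Fintype A] [DecidableEq A] in
/-- Conjugation commutes with the motion of the central `y`. [folklore] -/
theorem twZ_conj₄ (ζ : ZMod 2) (Θ : Ty₄ A) : twZ A ζ (conj₄ A Θ) = conj₄ A (twZ A ζ Θ) := by
  rw [conj₄_eq_twH₄, conj₄_eq_twH₄, twZ_twH₄]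

omit [DecidableEq A] in
/-- A `y`-translate of a pair is a pair. [folklore] -/
theorem translZ_pairVec₄ (ζ : ZMod 2) (Θ : Ty₄ A) : translZ A ζ (pairVec₄ A Θ) = pairVec₄ A (twZ A ζ Θ) := by
  classical
  show translZHom A ζ (Pi.single Θ 1 + Pi.single (conj₄ A Θ) 1) = Pi.single (twZ A ζ Θ) 1 + Pi.single (conj₄ A (twZ A ζ Θ)) 1
  rw [map_add, translZHom_apply, translZHom_apply, translZ_single, translZ_single, twZ_conj₄]

omit [DecidableEq A] in
/-- **`pairs₄` is stable under the motion of the central `y`.** [folklore] -/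
theorem translZ_mem_pairs₄ (ζ : ZMod 2) {v : Ty₄ A → ℤ} (hv : v ∈ pairs₄ A) : translZ A ζ v ∈ pairs₄ A := by
  rw [← translZHom_apply]
  refine Submodule.span_induction (p := fun w _ => translZHom A ζ w ∈ pairs₄ A) ?_ ?_ ?_ ?_ hv
  · rintro _ ⟨Θ, rfl⟩
    rw [translZHom_apply, translZ_pairVec₄]
    exact Submodule.subset_span ⟨_, rfl⟩
  · rw [map_zero]; exact Submodule.zero_mem _
  · intro x y _ _ hx hy; rw [map_add]; exact Submodule.add_mem _ hx hy
  · intro n x _ hx; rw [map_smul]; exact Submodule.smul_mem _ n hx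

end Hodge

/-! ## §3 Flips and faces are `y`-equivariant -/

section Faces

variable (A : Type) [AddCommGroup A] [DecidableEq A]

/-- The action of the central `y` on places: `(k, i) ↦ (σY k, i)` (coset indices swapped as in gen 44, NO inversion of `B`). [folklore] -/
def plZ (p : Pl A) : Pl A := (σY p.1, p.2)

omit [AddCommGroup A] [DecidableEq A] in
/-- `plZ` is an involution. [folklore] -/
@[simp] theorem plZ_plZ (p : Pl A) : plZ A (plZ A p) = p := by
  obtain ⟨k, i⟩ := p
  simp only [plZ, σY_σY]

omit [AddCommGroup A] [DecidableEq A] in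
/-- `plZ` is injective. [folklore] -/
theorem plZ_injective : Function.Injective (plZ A) := fun p q h => by
  rw [← plZ_plZ A p, h, plZ_plZ]

omit [AddCommGroup A] in
/-- **Flips are `y`-equivariant**: `twZ ζ (Θ^{(p)}) = (twZ ζ Θ)^{(y·p)}`. [folklore] -/
theorem twZ_flipAt (ζ : ZMod 2) (p : Pl A) (Θ : Ty₄ A) : twZ A ζ (flipAt A p Θ) = flipAt A (plZ A p) (twZ A ζ Θ) := by
  obtain ⟨k, i⟩ := p
  obtain ⟨⟨ψ₀, ψ₁⟩, ⟨ψ₂, ψ₃⟩⟩ := Θ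
  fin_cases k <;> simp [flipAt, plZ, σY, twZ, twV, add_right_comm]

variable [Fintype A]

/-- **A `y`-translate of a face is the face through the moved label at the moved places.** [folklore] -/
theorem translZ_faceVec₄ (ζ : ZMod 2) (Θ : Ty₄ A) (p q : Pl A) :
    translZ A ζ (faceVec₄ A Θ p q) = faceVec₄ A (twZ A ζ Θ) (plZ A p) (plZ A q) := by
  show translZHom A ζ (faceVec₄ A Θ p q) = _
  unfold faceVec₄
  simp only [map_add, translZHom_apply, translZ_single, twZ_conj₄, twZ_flipAt]

/-- **`faceSet₄` is stable under the motion of the central `y`.** [folklore] -/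
theorem translZ_mem_faceSet₄ (ζ : ZMod 2) {v : Ty₄ A → ℤ} (hv : v ∈ faceSet₄ A) : translZ A ζ v ∈ faceSet₄ A := by
  obtain ⟨Θ, p, q, hpq, rfl⟩ := hv
  exact ⟨_, _, _, fun h => hpq (plZ_injective A h), translZ_faceVec₄ A ζ Θ p q⟩

end Faces

/-! ## §4 Potential, coordinates and reducing pairs under the central `y` -/

section Potential

variable (A : Type) [AddCommGroup A] [Fintype A] [DecidableEq A]

omit [DecidableEq A] in
/-- The potential is invariant under the motion of the central `y`. [folklore] -/
theorem pot₄_twZ (ζ : ZMod 2) (Θ : Ty₄ A) : pot₄ A (twZ A ζ Θ) = pot₄ A Θ := by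
  obtain ⟨⟨ψ₀, ψ₁⟩, ⟨ψ₂, ψ₃⟩⟩ := Θ
  show clsTy A ψ₁ + clsTy A (ψ₀ + cst A ζ) + clsTy A ψ₃ + clsTy A (ψ₂ + cst A ζ) = clsTy A ψ₀ + clsTy A ψ₁ + clsTy A ψ₂ + clsTy A ψ₃
  rw [clsTy_add_cst, clsTy_add_cst]
  ring

omit [AddCommGroup A] [Fintype A] in
/-- The corners of a moved face are the moved corners (central `y`). [folklore] -/
theorem corner_twZ (ζ : ZMod 2) (Θ : Ty₄ A) (p q : Pl A) (c : Fin 3) :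
    corner A (twZ A ζ Θ) (plZ A p) (plZ A q) c = twZ A ζ (corner A Θ p q c) := by
  fin_cases c <;> simp [corner, twZ_flipAt]

omit [AddCommGroup A] [DecidableEq A] in
/-- Equal halves coordinatewise are preserved by the motion of the central `y` (`|B|` odd). [folklore] -/
theorem half_coord_twZ_eq_iff (hA : Odd (Fintype.card A)) (ζ : ZMod 2) (Θ Θ' : Ty₄ A) (n : Fin 4) :
    half A (coord A n (twZ A ζ Θ)) = half A (coord A n (twZ A ζ Θ')) ↔ half A (coord A (σY n) Θ) = half A (coord A (σY n) Θ') := by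
  obtain ⟨⟨ψ₀, ψ₁⟩, ⟨ψ₂, ψ₃⟩⟩ := Θ
  obtain ⟨⟨ψ₀', ψ₁'⟩, ⟨ψ₂', ψ₃'⟩⟩ := Θ'
  fin_cases n <;> simp only [coord, twZ, twV, σY, Matrix.cons_val_zero, Matrix.cons_val_one, Matrix.cons_val, Fin.zero_eta, Fin.mk_one,
    Fin.reduceFinMk, half_add_cst_eq_iff A hA]

/-- **Reducing pairs move with the labels (central `y`).** [folklore] -/
theorem reducing_twZ (hA : Odd (Fintype.card A)) (ζ : ZMod 2) {Θ : Ty₄ A} {p q : Pl A}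
    (h : p ≠ q ∧ ∀ c, pot₄ A (corner A Θ p q c) < pot₄ A Θ ∧ ∀ n, half A (coord A n (corner A Θ p q c)) = half A (coord A n Θ)) :
    plZ A p ≠ plZ A q ∧ ∀ c, pot₄ A (corner A (twZ A ζ Θ) (plZ A p) (plZ A q) c) < pot₄ A (twZ A ζ Θ) ∧
      ∀ n, half A (coord A n (corner A (twZ A ζ Θ) (plZ A p) (plZ A q) c)) = half A (coord A n (twZ A ζ Θ)) := by
  refine ⟨fun e => h.1 (plZ_injective A e), fun c => ⟨?_, fun n => ?_⟩⟩
  · rw [corner_twZ, pot₄_twZ, pot₄_twZ]; exact (h.2 c).1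
  · rw [corner_twZ, half_coord_twZ_eq_iff A hA]; exact (h.2 c).2 _

end Potential

end

end Summit.HodgeConjecture.CorCM.Census.OcticProduct
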